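import Literature.AnabelianGeometry.EtaleTheta.TemperedFrobenioidOfBaseFieldHull
import Literature.AnabelianGeometry.EtaleTheta.Discharge.Sec4RootLawBaseFieldHull
import Literature.AnabelianGeometry.EtaleTheta.Discharge.Sec4BaseRootLawSmallIndex
import Literature.AnabelianGeometry.EtaleTheta.Discharge.Sec3Thm37SubQFT
import Literature.AlgebraicGeometry.Frobenioids.ModelFrobenioidCofinal
import HarnessLib

/-!
# [EtTh] Prop. 4.2 (iii) inputs AT THE BASE-FIELD-THEORETIC HULL: the coprimality pull-back law `hDSpull` (rank one) and the §4 binder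
# A10 `BaseRootLaw «Galois»` (from the Kummer root law) — PROOF-ONLY

S. Mochizuki, *The étale theta function …*, Publ. RIMS **45** (2009) [MochizukiEtTh2009], Prop. 4.2 (iii) pp.314–315 (PDF pp.88–89)
(«`Div(s'), Div(s'')` have disjoint supports [cf. [FrdI], Proposition 4.1, (iii)]»; «admits an `N`-th root over some tempered covering» —
ERRATUM E2, [IUTchI] Rmk. 3.2.4 (i)(a)); [FrdI] Prop. 4.1 (iii) p.86.  [cite: MochizukiEtTh2009, Prop 4.2 (iii) p.315 (PDF p.89)]

abc-iut cell, layer L2, seat abc-iut-L2-d3 (gen 10); L2-lead ruling R1112 «CONST-DICT CARRIER = C^{bs-fld} HULL OVER THE GENUINE BASE»,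
junction step (c).  PROOF-ONLY (0 definitions, no `Prop`-valued definition, no instance, no notation, no sorry) over this lineage's hull
`BsFldHull.temperedFrobenioid p a ha hΓ R S` (p500929; base functor = the equivalence `B^temp(Γ)⁰ ⥤ CosetCat Γ`) and its Kummer root law
`DivisorMonoids.rootLaw_bsFldHull` (p507462), consuming BY NAME abc-iut-L2-t3's transfers (`TemperedFrobenioid.baseRootLaw_of_rootLaw`,
`CosetCat.hLift_galois_of_full_essSurj`, `BaseRootLaw.of_iff`, `CosetCat.isGaloisObj_toConnected_inverse_iff` — `Discharge/Sec4BaseRootLawSmallIndex`),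
abc-iut-w6-d048's `RankOneBase.isMonoprime_pfImage` and abc-iut-L1's `IsMonoprime.dvd_or_dvd`:
* `BsFldHull.coprime_cases` — in the RANK-ONE divisor monoid `Φ(A) ≅ ℚ_{≥0}` of the hull two coprime elements cannot both be non-trivial
  (divisibility is total);  **`BsFldHull.hDSpull`** — hence [FrdI] Prop. 4.1 (iii) coprimality PULLS BACK along every base morphism (`Φ` sharp:
  abc-iut-L2-t3's `isDivisorial_divisorMonoid`) — the `hDSpull` input of abc-iut-w5-d134's / w4-d044's Prop. 4.2 (iii) pipeline;
* **`BsFldHull.baseRootLaw`** — A10 `BaseRootLaw «A Galois»` for the hull (continuous `a`): every function of a GALOIS object acquires an `N`-th root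
  over a Galois cover — the `hR₀` input of the pipeline (`Prop42Sub.prop42_iii_iv_mkOfModelCanonical_of_baseRootLaw_treeCatVocabWeak`, where `hTF` is
  abc-iut-w6-d037's theorem `pow_injective_ΦR_gp_treeVocabWeak`); what remains for Prop. 4.2 (iii) at the hull is the `μ_N`-saturation refinement
  `hE` (a Kummer covering adjoining `ζ_N`) and, for (iv), `hL`.
HONEST FRAMING: classical Kummer theory at a carrier with degenerate divisor geometry; nothing of [EtTh] is asserted; nothing here bears on
[IUTchIII] Cor. 3.12; no side taken; typed ≠ proved elsewhere.
-/

noncomputable section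

namespace Literature.AnabelianGeometry.EtaleTheta

open CategoryTheory Opposite Function Literature.AlgebraicGeometry.Frobenioids Literature.AnabelianGeometry.SemiGraphs

namespace BsFldHull

variable (p : ℕ) [Fact p.Prime] {Γ : Type} [Group Γ] [TopologicalSpace Γ] (a : Γ →* GQp p)
  (ha : ∀ U : OpenSubgroup Γ, IsOpen ((U.toSubgroup.map a : Subgroup (GQp p)) : Set (GQp p))) [IsTopologicalGroup Γ]
  (hΓ : IsTempered Γ) (R S : ((ConnectedPart (BTemp Γ))ᵒᵖ ⥤ CommMonCat.{0}) → Prop)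

/-- **Coprime elements of the rank-one divisor monoid `Φ(A)` of the hull: one of them is trivial** (divisibility is total in a monoprime monoid —
abc-iut-L1's `IsMonoprime.dvd_or_dvd` at abc-iut-w6-d048's `isMonoprime_pfImage`).  [cite: MochizukiFrdI2008, Prop. 4.1 (iii) p.86] -/
theorem coprime_cases (A : (ConnectedPart (BTemp Γ))ᵒᵖ) {x y : (temperedFrobenioid p a ha hΓ R S).Φ.carrier A}
    (h : ∀ z : (temperedFrobenioid p a ha hΓ R S).Φ.carrier A, z ∣ x → z ∣ y → z = 1) : x = 1 ∨ y = 1 := by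
  have hmono : IsMonoprime ((temperedFrobenioid p a ha hΓ R S).Φ.carrier A) :=
    TemperedFrobenioid.RankOneBase.isMonoprime_pfImage (hpf p a ha) (rankOneBase p a ha hΓ) A
  rcases hmono.dvd_or_dvd x y with hxy | hyx
  · exact Or.inl (h x (dvd_refl x) hxy)
  · exact Or.inr (h y hyx (dvd_refl y))

/-- **`hDSpull` at the hull**: the [FrdI] Prop. 4.1 (iii) coprimality predicate pulls back along every base morphism (one of the two divisors is
trivial, pull-back is a homomorphism, `Φ(A')` is sharp).  [cite: MochizukiEtTh2009, Prop 4.2 (iii) p.315 (PDF p.89)] -/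
theorem hDSpull {A A' : ConnectedPart (BTemp Γ)} (e : A' ⟶ A) {x y : (temperedFrobenioid p a ha hΓ R S).Φ.carrier (op A)}
    (h : ∀ z : (temperedFrobenioid p a ha hΓ R S).Φ.carrier (op A), z ∣ x → z ∣ y → z = 1)
    (w : (temperedFrobenioid p a ha hΓ R S).Φ.carrier (op A'))
    (hwx : w ∣ pull (temperedFrobenioid p a ha hΓ R S).divisorMonoid e x) (hwy : w ∣ pull (temperedFrobenioid p a ha hΓ R S).divisorMonoid e y) :
    w = 1 := by
  have hsharp := ((temperedFrobenioid p a ha hΓ R S).isDivisorial_divisorMonoid A').isSharp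
  rcases coprime_cases p a ha hΓ R S (op A) h with hx | hy
  · have h1 : pull (temperedFrobenioid p a ha hΓ R S).divisorMonoid e x = 1 := by rw [hx]; exact map_one _
    rw [h1] at hwx
    exact hsharp.eq_one_of_isUnit w (isUnit_of_dvd_one hwx)
  · have h1 : pull (temperedFrobenioid p a ha hΓ R S).divisorMonoid e y = 1 := by rw [hy]; exact map_one _
    rw [h1] at hwy
    exact hsharp.eq_one_of_isUnit w (isUnit_of_dvd_one hwy)

/-- **A10 `BaseRootLaw «Galois»` HOLDS at the hull** (continuous `a`): every function `b ∈ B₀(Γ/U)` of a GALOIS object acquires, for every `N ≥ 1`,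
an `N`-th root over a Galois cover (this lineage's Kummer root law `rootLaw_bsFldHull` + abc-iut-L2-t3's lift «pass to a Galois closure» along the
equivalence base functor).  [cite: MochizukiEtTh2009, Prop 4.2 (iii) p.315 (PDF p.89)] -/
theorem baseRootLaw (hcont : Continuous a) : (temperedFrobenioid p a ha hΓ R S).BaseRootLaw fun A => IsGaloisObj A.obj := by
  have h := (temperedFrobenioid p a ha hΓ R S).baseRootLaw_of_rootLaw (DivisorMonoids.rootLaw_bsFldHull p a ha hcont) _
    (CosetCat.hLift_galois_of_full_essSurj (CosetCat.equivConnectedPart hΓ).inverse hΓ)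
  exact TemperedFrobenioid.BaseRootLaw.of_iff _ (fun A => CosetCat.isGaloisObj_toConnected_inverse_iff hΓ A) h

end BsFldHull

end Literature.AnabelianGeometry.EtaleTheta

end
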